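import Mathlib
import Literature.NumberTheory.LFunctions.Zhang2022.Section17Eq172Shift
import Literature.NumberTheory.LFunctions.Zhang2022.Section17Phi3plusLine
import Literature.NumberTheory.LFunctions.Zhang2022.TypedSection17NuStarBound
import Literature.NumberTheory.LFunctions.Zhang2022.ToolkitDivisorMajorants
import HarnessLib

/-!
# Zhang (2022) §17 (17.2), second half, per character: on `𝔍(1)` the integrand `𝔨₃(s,ψ)ω(s)` is,
# up to a polynomially small tail, the ENTIRE function `K_M(s,ψ)F(1−s,ψ̄)ω(s)`, whose integral moves
# to the critical segment `𝔍(0)`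

Topic `Literature/NumberTheory/LFunctions/Zhang2022` (Landau–Siegel audit tree; verdict-neutral).
Y. Zhang, *Discrete mean estimates and the Landau–Siegel zero*, arXiv:2211.02515v1 (2022)
[Zhang2022LandauSiegel] — **an unrefereed manuscript under adjudication**; nothing here asserts or
denies its Theorems 1–2. DAG node `Z22:(17.2)` [Z22 p.95, (17.2), tex L4711–L4716], the clause
"and then extend the sum over `Ψ₁` to the sum over `Ψ` with an acceptable error", which §17 does not
prove; §14 p.76 and §7 p.35 (tex L1893–L1905) give the method for the twin (14.3)/(7.3): "To handle the
sum over `m < P²` we move the path of integration to `𝔍(0)` … by Cauchy's inequality … This yields (7.5)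
by Proposition 2.1 and (2.9)." This file is the PER-CHARACTER half of that method for the §17 integrand,
valid for EVERY `ψ ∈ Ψ` (no Proposition 2.2 is needed on `𝔍(1)`):

* `norm_LSeries_nuStar_sub_head_le` — on `Re s = 3/2` the Dirichlet series
  `Σ_m ν*(m)ψ(m)m^{−s} = (L(s+β₁,ψ)/L(s,ψ))B(s,ψ)G(s,ψ)N(s+β₂,ψ)N(s+β₃,ψ)` (§17.u004, tree theorem
  `Typed.Section17.step17_u004_holds` behind `Phi3TermByTerm.kfrak3_mul_omega_eq`) differs from its head
  `K_M(s,ψ) = Σ_{m≤M} ν*(m)ψ(m)m^{−s}` by at most `K_ι M^{−1/4} S₈`, `S₈ = Σ_n τ₈(n)n^{−5/4}`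
  (`|ν*| ≤ K_ιτ₈`, `Typed.Section17.norm_nuStar_le_tau`);
* `norm_segInt_kfrak3_sub_head_le` — hence `‖(1/2πi)∫_{𝔍(1)}𝔨₃ω − (1/2πi)∫_{𝔍(1)}K_M F(1−s,ψ̄)ω‖
  ≤ (𝓛₁/π)·K_ιM^{−1/4}S₈·D⁵⁶·3` (`|F(1−s,ψ̄)| ≤ D⁵⁶`, `|ω| ≤ 3` on `𝔍(1)`);
* `norm_segInt_head_shift_le` — "we move the path of integration to `𝔍(0)`": the head integrand is
  entire, so by Cauchy (`Section7aStatements.norm_intJ_sub_intJ_le`)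
  `‖(1/2πi)∫_{𝔍(1)}K_MF̄ω − (1/2πi)∫_{𝔍(0)}K_MF̄ω‖ ≤ (1/π)·K_ιM⁸D⁵⁶·6e^{−𝓛¹⁰/4}`.

Theorems only; no definitions, no named facts; axioms standard. ZHANG-L discharge lane (WP16, seat
zl-w16-p6), helper toward the leaf `Typed.Section17.Eq17_6Rel` (chain (17.2) → (17.6)); the
`Ψ₁ → Ψ` extension itself (Hölder + large sieve + Prop. 2.1 on `𝔍(0)`) is the companion
`Section17Eq172Extension`. WHAT THIS IS NOT: a claim about (17.2) as a whole, about Theorems 1–2 of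
the source, or about Landau–Siegel zeros.

## References

* Y. Zhang, arXiv:2211.02515v1 (2022), §17 (17.2) p.95; §14 (14.3) p.76; §7 (7.3)–(7.5) pp.34–35.
  [cite: Zhang2022LandauSiegel, §17 (17.2) p.95]
-/

noncomputable section

open Complex Real Set MeasureTheory intervalIntegral
open Literature.NumberTheory.LFunctions.Zhang2022.Skeleton
open Literature.NumberTheory.LFunctions.Zhang2022.Typed.Section17
open Literature.NumberTheory.LFunctions.Zhang2022.MeanSquareMajorant (tau)

namespace Literature.NumberTheory.LFunctions.Zhang2022.Eq172

/-! ## Elementary sizes -/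

/-- `τ_{j+1}(n) ≤ n^j` for `n ≥ 1` (from the recursion `τ_{j+1}(n) = Σ_{d∣n} τ_j(d)` and `d(n) ≤ n`).
[cite: Ivic1985, §1.6, p. 31 (recursion for d_k)] -/
private theorem tau_succ_le_pow (j : ℕ) {n : ℕ} (hn : n ≠ 0) :
    tau (j + 1) n ≤ (n : ℝ) ^ j := by
  induction j generalizing n with
  | zero => rw [MeanSquareMajorant.tau_one_apply hn, pow_zero]
  | succ j ih =>
      rw [MeanSquareMajorant.tau_succ_apply]
      calc ∑ d ∈ n.divisors, tau (j + 1) d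
          ≤ ∑ _d ∈ n.divisors, (n : ℝ) ^ j := by
            refine Finset.sum_le_sum fun d hd => ?_
            have hd0 : d ≠ 0 := (Nat.pos_of_mem_divisors hd).ne'
            have hdn : (d : ℝ) ≤ n := by exact_mod_cast Nat.divisor_le hd
            exact (ih hd0).trans (pow_le_pow_left₀ (Nat.cast_nonneg _) hdn j)
        _ = (n.divisors.card : ℝ) * (n : ℝ) ^ j := by rw [Finset.sum_const, nsmul_eq_mul]
        _ ≤ (n : ℝ) * (n : ℝ) ^ j := by
            gcongr; exact_mod_cast Nat.card_divisors_le_self n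
        _ = (n : ℝ) ^ (j + 1) := by ring

/-- The coefficient constant `K_ι = (1+|ι₂|)(|ι₃|+|ι₄|) ≥ 0` of `Typed.Section17.norm_nuStar_le_tau`.
[cite: Zhang2022LandauSiegel, §17 u004 p.96] -/
theorem Kiota_nonneg : 0 ≤ (1 + ‖iota2‖) * (‖iota3‖ + ‖iota4‖) := by positivity

/-! ## The head `K_M(s,ψ)` of the `ν*`-series and the tail on `Re s = 3/2` -/

section Head

variable (c' : ℝ) {D : ℕ} [NeZero D] (χ : DirichletCharacter ℂ D)

omit [NeZero D] in
/-- The head is the initial segment of the `L`-series: `Σ_{1≤m≤M} a(m)m^{−s} = Σ_{m<M+1} term a s m`.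
[folklore] -/
private theorem head_eq_sum_range_term (a : ℕ → ℂ) (M : ℕ) (s : ℂ) :
    ∑ m ∈ Finset.Icc 1 M, a m * (m : ℂ) ^ (-s) = ∑ m ∈ Finset.range (M + 1), LSeries.term a s m := by
  rw [Finset.range_eq_Ico, Finset.sum_eq_sum_Ico_succ_bot (Nat.succ_pos M), LSeries.term_zero,
    zero_add]
  refine Finset.sum_congr (by ext n; simp only [Finset.mem_Ico, Finset.mem_Icc]; omega) fun n hn => ?_
  have hn0 : n ≠ 0 := by have := (Finset.mem_Icc.mp hn).1; omega
  rw [LSeries.term_of_ne_zero hn0, div_eq_mul_inv, Complex.cpow_neg]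

omit [NeZero D] in
/-- **The tail of the `ν*`-series on `Re s = 3/2`**: for `𝓛 ≥ 2`, `M ≥ 1`, every `ψ ∈ Ψ`,
`‖Σ_m ν*(m)ψ(m)m^{−s} − Σ_{m≤M} ν*(m)ψ(m)m^{−s}‖ ≤ K_ι·M^{−1/4}·Σ_n τ₈(n)n^{−5/4}`
(`|ν*(m)| ≤ K_ιτ₈(m)`, `m^{−3/2} ≤ M^{−1/4}m^{−5/4}` for `m > M`).
[cite: Zhang2022LandauSiegel, §17 u004 p.96; §7 p.35 ("the sum over `m ≥ P²`")] -/
theorem norm_LSeries_nuStar_sub_head_le (hD : 2 ≤ Real.log D) (x : Chr D) {M : ℕ} (hM : 0 < M)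
    {s : ℂ} (hs : s.re = 3 / 2) :
    ‖LSeries (fun m => nuStar c' χ m * psiFn x m) s -
        ∑ m ∈ Finset.Icc 1 M, nuStar c' χ m * psiFn x m * (m : ℂ) ^ (-s)‖ ≤
      (1 + ‖iota2‖) * (‖iota3‖ + ‖iota4‖) * (M : ℝ) ^ (-(1 / 4 : ℝ)) *
        ∑' n : ℕ, tau 8 n / (n : ℝ) ^ (5 / 4 : ℝ) := by
  set a : ℕ → ℂ := fun m => nuStar c' χ m * psiFn x m with ha
  set K : ℝ := (1 + ‖iota2‖) * (‖iota3‖ + ‖iota4‖) with hK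
  have hK0 : 0 ≤ K := Kiota_nonneg
  have hsum : LSeriesSummable a s :=
    Phi3TermByTerm.LSeriesSummable_nuStar_psi c' χ x (by rw [hs]; norm_num)
  -- split off the head
  have hsplit := hsum.sum_add_tsum_nat_add (M + 1)
  have hhead : ∑ m ∈ Finset.Icc 1 M, nuStar c' χ m * psiFn x m * (m : ℂ) ^ (-s) =
      ∑ m ∈ Finset.range (M + 1), LSeries.term a s m := head_eq_sum_range_term a M s
  have hdiff : LSeries a s - ∑ m ∈ Finset.Icc 1 M, nuStar c' χ m * psiFn x m * (m : ℂ) ^ (-s) =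
      ∑' i : ℕ, LSeries.term a s (i + (M + 1)) := by
    rw [hhead, LSeries, ← hsplit]; ring
  rw [hdiff]
  -- the majorant `g(n) = τ₈(n) n^{-5/4}`
  set g : ℕ → ℝ := fun n => tau 8 n / (n : ℝ) ^ (5 / 4 : ℝ) with hg
  have hg_sum : Summable g := MeanSquareMajorant.summable_tau_div_rpow 8 (by norm_num)
  have hg0 : ∀ n, 0 ≤ g n := fun n => by
    rw [hg]; exact div_nonneg (MeanSquareMajorant.tau_nonneg _ _) (by positivity)
  have hMr : (0 : ℝ) < M := by exact_mod_cast hM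
  have hMq : 0 ≤ (M : ℝ) ^ (-(1 / 4 : ℝ)) := by positivity
  -- termwise bound beyond `M`
  have hterm : ∀ i : ℕ, ‖LSeries.term a s (i + (M + 1))‖ ≤ K * (M : ℝ) ^ (-(1 / 4 : ℝ)) *
      g (i + (M + 1)) := by
    intro i
    set n : ℕ := i + (M + 1) with hn
    have hn0 : n ≠ 0 := by omega
    have hnr : (0 : ℝ) < n := by exact_mod_cast Nat.pos_of_ne_zero hn0
    have hMn : (M : ℝ) ≤ n := by exact_mod_cast (by omega : M ≤ n)
    rw [LSeries.norm_term_eq, if_neg hn0, hs]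
    have h1 : ‖a n‖ ≤ K * tau 8 n := by
      rw [ha]
      simp only
      rw [norm_mul]
      calc ‖nuStar c' χ n‖ * ‖psiFn x n‖ ≤ K * tau 8 n * 1 :=
            mul_le_mul (norm_nuStar_le_tau c' χ hD n) (x.ψ.norm_le_one _) (norm_nonneg _)
              (mul_nonneg hK0 (MeanSquareMajorant.tau_nonneg _ _))
        _ = K * tau 8 n := mul_one _
    have h2 : (n : ℝ) ^ (-(1 / 4 : ℝ)) ≤ (M : ℝ) ^ (-(1 / 4 : ℝ)) :=
      Real.rpow_le_rpow_of_nonpos hMr hMn (by norm_num)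
    have hsplit' : (1 : ℝ) / (n : ℝ) ^ (3 / 2 : ℝ) = (n : ℝ) ^ (-(1 / 4 : ℝ)) * (1 / (n : ℝ) ^ (5 / 4 : ℝ)) := by
      rw [Real.rpow_neg hnr.le, show (3 / 2 : ℝ) = 1 / 4 + 5 / 4 by norm_num,
        Real.rpow_add hnr]
      field_simp
    calc ‖a n‖ / (n : ℝ) ^ (3 / 2 : ℝ) = ‖a n‖ * (1 / (n : ℝ) ^ (3 / 2 : ℝ)) := by ring
      _ ≤ (K * tau 8 n) * ((n : ℝ) ^ (-(1 / 4 : ℝ)) * (1 / (n : ℝ) ^ (5 / 4 : ℝ))) := by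
          rw [← hsplit']; exact mul_le_mul_of_nonneg_right h1 (by positivity)
      _ ≤ (K * tau 8 n) * ((M : ℝ) ^ (-(1 / 4 : ℝ)) * (1 / (n : ℝ) ^ (5 / 4 : ℝ))) := by
          apply mul_le_mul_of_nonneg_left _ (mul_nonneg hK0 (MeanSquareMajorant.tau_nonneg _ _))
          exact mul_le_mul_of_nonneg_right h2 (by positivity)
      _ = K * (M : ℝ) ^ (-(1 / 4 : ℝ)) * g n := by rw [hg]; ring
  -- summability of the shifted majorant and of the shifted norms
  have hg_shift : Summable fun i : ℕ => g (i + (M + 1)) := (summable_nat_add_iff (M + 1)).mpr hg_sum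
  have hmaj : Summable fun i : ℕ => K * (M : ℝ) ^ (-(1 / 4 : ℝ)) * g (i + (M + 1)) :=
    hg_shift.mul_left _
  have hnorm : Summable fun i : ℕ => ‖LSeries.term a s (i + (M + 1))‖ :=
    Summable.of_nonneg_of_le (fun _ => norm_nonneg _) hterm hmaj
  have htail_le : ∑' i : ℕ, g (i + (M + 1)) ≤ ∑' n : ℕ, g n := by
    rw [← hg_sum.sum_add_tsum_nat_add (M + 1)]
    have : 0 ≤ ∑ i ∈ Finset.range (M + 1), g i := Finset.sum_nonneg fun i _ => hg0 i
    linarith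
  calc ‖∑' i : ℕ, LSeries.term a s (i + (M + 1))‖
      ≤ ∑' i : ℕ, ‖LSeries.term a s (i + (M + 1))‖ := norm_tsum_le_tsum_norm hnorm
    _ ≤ ∑' i : ℕ, K * (M : ℝ) ^ (-(1 / 4 : ℝ)) * g (i + (M + 1)) := hnorm.tsum_le_tsum hterm hmaj
    _ = K * (M : ℝ) ^ (-(1 / 4 : ℝ)) * ∑' i : ℕ, g (i + (M + 1)) := tsum_mul_left
    _ ≤ K * (M : ℝ) ^ (-(1 / 4 : ℝ)) * ∑' n : ℕ, g n :=
        mul_le_mul_of_nonneg_left htail_le (mul_nonneg hK0 hMq)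

omit [NeZero D] in
/-- **The head of `𝔨₃(s,ψ)` is polynomially bounded**: for `𝓛 ≥ 2`, `M ≥ 1`, `Re s ≥ 0`,
`‖Σ_{m≤M} ν*(m)ψ(m)m^{−s}‖ ≤ K_ι·M⁸` (`|ν*| ≤ K_ιτ₈`, `τ₈(m) ≤ m⁷`, `|m^{−s}| ≤ 1`).
[cite: Zhang2022LandauSiegel, §17 u004 p.96] -/
theorem norm_head_le (hD : 2 ≤ Real.log D) (x : Chr D) (M : ℕ) {s : ℂ} (hs : 0 ≤ s.re) :
    ‖∑ m ∈ Finset.Icc 1 M, nuStar c' χ m * psiFn x m * (m : ℂ) ^ (-s)‖ ≤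
      (1 + ‖iota2‖) * (‖iota3‖ + ‖iota4‖) * (M : ℝ) ^ 8 := by
  set K : ℝ := (1 + ‖iota2‖) * (‖iota3‖ + ‖iota4‖) with hK
  have hK0 : 0 ≤ K := Kiota_nonneg
  have hterm : ∀ m ∈ Finset.Icc 1 M, ‖nuStar c' χ m * psiFn x m * (m : ℂ) ^ (-s)‖ ≤ K * (M : ℝ) ^ 7 := by
    intro m hm
    obtain ⟨h1, h2⟩ := Finset.mem_Icc.mp hm
    have hm0 : m ≠ 0 := by omega
    have hmr : (0 : ℝ) < m := by exact_mod_cast h1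
    rw [norm_mul, norm_mul]
    have hν : ‖nuStar c' χ m‖ ≤ K * (M : ℝ) ^ 7 := by
      refine (norm_nuStar_le_tau c' χ hD m).trans (mul_le_mul_of_nonneg_left ?_ hK0)
      calc tau 8 m ≤ (m : ℝ) ^ 7 := tau_succ_le_pow 7 hm0
        _ ≤ (M : ℝ) ^ 7 := pow_le_pow_left₀ hmr.le (by exact_mod_cast h2) 7
    have hψ : ‖psiFn x m‖ ≤ 1 := x.ψ.norm_le_one _
    have hc : ‖(m : ℂ) ^ (-s)‖ ≤ 1 := by
      rw [Complex.norm_natCast_cpow_of_pos h1]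
      exact Real.rpow_le_one_of_one_le_of_nonpos (by exact_mod_cast h1) (by simpa using hs)
    calc ‖nuStar c' χ m‖ * ‖psiFn x m‖ * ‖(m : ℂ) ^ (-s)‖ ≤ K * (M : ℝ) ^ 7 * 1 * 1 := by
          gcongr
      _ = K * (M : ℝ) ^ 7 := by ring
  calc ‖∑ m ∈ Finset.Icc 1 M, nuStar c' χ m * psiFn x m * (m : ℂ) ^ (-s)‖
      ≤ ∑ m ∈ Finset.Icc 1 M, ‖nuStar c' χ m * psiFn x m * (m : ℂ) ^ (-s)‖ := norm_sum_le _ _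
    _ ≤ ∑ m ∈ Finset.Icc 1 M, K * (M : ℝ) ^ 7 := Finset.sum_le_sum hterm
    _ = M * (K * (M : ℝ) ^ 7) := by rw [Finset.sum_const, Nat.card_Icc, nsmul_eq_mul]; norm_num
    _ = K * (M : ℝ) ^ 8 := by ring

omit [NeZero D] in
/-- The head polynomial `K_M(s,ψ) = Σ_{m≤M} ν*(m)ψ(m)m^{−s}` is entire (a finite Dirichlet polynomial over
`m ≥ 1`). [cite: Zhang2022LandauSiegel, §17 u004 p.96] -/
theorem differentiable_head (x : Chr D) (M : ℕ) :
    Differentiable ℂ fun s : ℂ => ∑ m ∈ Finset.Icc 1 M, nuStar c' χ m * psiFn x m * (m : ℂ) ^ (-s) := by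
  refine Differentiable.fun_sum fun m hm => ?_
  have hm0 : (m : ℂ) ≠ 0 := Nat.cast_ne_zero.mpr (by have := (Finset.mem_Icc.mp hm).1; omega)
  exact (differentiable_id.neg.const_cpow (Or.inl hm0)).const_mul _

end Head

/-! ## `𝔨₃ω` versus the head integrand on `𝔍(1)`, and the move to `𝔍(0)` -/

section Segment

variable (c' : ℝ) {D : ℕ} [NeZero D] (χ : DirichletCharacter ℂ D)

/-- On `Re s > 1`, `𝔨₃(s,ψ)ω(s) = (Σ_m ν*(m)ψ(m)m^{−s})·F(1−s,ψ̄)·ω(s)` (§17.u004 with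
`F(1−s,ψ̄) = Σ_{n≤D⁴}ν(n)ψ̄(n)n^{s−1}`; the tree's `Phi3TermByTerm.kfrak3_mul_omega_eq`).
[cite: Zhang2022LandauSiegel, §17 u004 p.96] -/
theorem kfrak3_omega_eq_LSeries_FpolyBar (x : Chr D) {s : ℂ} (hs : 1 < s.re) :
    kfrak3 c' χ x s * omegaW D s =
      LSeries (fun m => nuStar c' χ m * psiFn x m) s * FpolyBar χ x (1 - s) * omegaW D s := by
  rw [Phi3TermByTerm.kfrak3_mul_omega_eq c' χ x hs]
  have hF : FpolyBar χ x (1 - s) =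
      ∑ n ∈ Finset.Icc 1 (D ^ 4), nu χ n * (starRingEnd ℂ) (x.ψ (n : ZMod x.p)) * (n : ℂ) ^ (s - 1) := by
    rw [FpolyBar]
    refine Finset.sum_congr rfl fun n _ => ?_
    rw [neg_sub]
  rw [hF]
  rfl

/-- **Truncating the `ν*`-series inside `(1/2πi)∫_{𝔍(1)}`**: for `D ≥ 3` with `𝓛 ≥ 3`, `M ≥ 1`,
every `ψ ∈ Ψ`,
`‖(1/2πi)∫_{𝔍(1)}𝔨₃ω − (1/2πi)∫_{𝔍(1)}K_MF(1−s,ψ̄)ω‖ ≤ (𝓛₁/π)·(K_ιM^{−1/4}S₈)·D⁵⁶·3`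
(length `2𝓛₁`, `|F(1−s,ψ̄)| ≤ D⁵⁶`, `|ω| ≤ √πe^{1/4} ≤ 3` on `𝔍(1)`).
[cite: Zhang2022LandauSiegel, §17 (17.2) p.95; §7 p.35] -/
theorem norm_segInt_kfrak3_sub_head_le (hD3 : 3 ≤ D) (hℓ : 3 ≤ ell D) (x : Chr D) {M : ℕ}
    (hM : 0 < M) :
    ‖Lemma81.segInt (t0 D) (ell1 D) 1 (fun s => kfrak3 c' χ x s * omegaW D s) -
        Lemma81.segInt (t0 D) (ell1 D) 1 (fun s =>
          (∑ m ∈ Finset.Icc 1 M, nuStar c' χ m * psiFn x m * (m : ℂ) ^ (-s)) *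
            FpolyBar χ x (1 - s) * omegaW D s)‖ ≤
      (ell1 D / π) * ((1 + ‖iota2‖) * (‖iota3‖ + ‖iota4‖) * (M : ℝ) ^ (-(1 / 4 : ℝ)) *
        ∑' n : ℕ, tau 8 n / (n : ℝ) ^ (5 / 4 : ℝ)) * (D : ℝ) ^ 56 * 3 := by
  have hlog : 2 ≤ Real.log D := le_trans (by norm_num) hℓ
  have hD1 : 1 ≤ D := le_trans (by norm_num) hD3
  have hℓ1pos : 0 ≤ ell1 D := pow_nonneg (by linarith) _
  have hℓ2 : 1 ≤ ell2 D := by rw [ell2]; exact one_le_pow₀ (by linarith)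
  set F : ℂ → ℂ := fun s => kfrak3 c' χ x s * omegaW D s with hF
  set G : ℂ → ℂ := fun s => (∑ m ∈ Finset.Icc 1 M, nuStar c' χ m * psiFn x m * (m : ℂ) ^ (-s)) *
    FpolyBar χ x (1 - s) * omegaW D s with hG
  set T : ℝ := (1 + ‖iota2‖) * (‖iota3‖ + ‖iota4‖) * (M : ℝ) ^ (-(1 / 4 : ℝ)) *
    ∑' n : ℕ, tau 8 n / (n : ℝ) ^ (5 / 4 : ℝ) with hT
  have hT0 : 0 ≤ T := by
    rw [hT]
    exact mul_nonneg (mul_nonneg Kiota_nonneg (by positivity))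
      (tsum_nonneg fun n => div_nonneg (MeanSquareMajorant.tau_nonneg _ _) (by positivity))
  -- the line through `𝔍(1)`: `s_v = 1 + s₀ + iv`, `Re s_v = 3/2`
  have hpt : ∀ v : ℝ, ((1 : ℂ) + s0 D + v * I) = (((3 / 2 : ℝ) : ℂ) + ((2 * π * t0 D + v : ℝ) : ℂ) * I) := by
    intro v; rw [s0, SmoothWeight.s0_def]; push_cast; ring
  have hre : ∀ v : ℝ, ((1 : ℂ) + s0 D + v * I).re = 3 / 2 := by
    intro v; rw [hpt]; simp
  -- pointwise bound on the difference along the line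
  have hbound : ∀ v : ℝ, ‖F ((1 : ℂ) + s0 D + v * I) - G ((1 : ℂ) + s0 D + v * I)‖ ≤
      T * (D : ℝ) ^ 56 * 3 := by
    intro v
    set s : ℂ := (1 : ℂ) + s0 D + v * I with hs
    have hsre : s.re = 3 / 2 := hre v
    have hkey : F s - G s = (LSeries (fun m => nuStar c' χ m * psiFn x m) s -
        ∑ m ∈ Finset.Icc 1 M, nuStar c' χ m * psiFn x m * (m : ℂ) ^ (-s)) *
        FpolyBar χ x (1 - s) * omegaW D s := by
      simp only [hF, hG]
      rw [kfrak3_omega_eq_LSeries_FpolyBar c' χ x (by rw [hsre]; norm_num)]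
      ring
    rw [hkey, norm_mul, norm_mul]
    have h1 := norm_LSeries_nuStar_sub_head_le c' χ hlog x hM hsre
    have h2 : ‖FpolyBar χ x (1 - s)‖ ≤ (D : ℝ) ^ 56 :=
      Section4.norm_FpolyBar_le_pow χ x hD1 (by simp [hsre]; norm_num)
    have h3 : ‖omegaW D s‖ ≤ 3 := by
      have hs' : s = ((1 : ℝ) : ℂ) + SmoothWeight.s0 (t0 D) + v * I := by
        rw [hs, Complex.ofReal_one]; rfl
      rw [omegaW, hs', SmoothWeight.norm_omega_segment_eq (by linarith) (t0 D) 1 v]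
      have hexp : Real.exp ((1 ^ 2 - v ^ 2) / (4 * ell2 D ^ 2)) ≤ Real.exp (1 / 4) := by
        rw [Real.exp_le_exp, one_pow]
        have hv : 0 ≤ v ^ 2 := sq_nonneg v
        have h4 : 0 < 4 * ell2 D ^ 2 := by nlinarith
        have hℓ2sq : 1 ≤ ell2 D ^ 2 := by nlinarith
        rw [div_le_div_iff₀ h4 (by norm_num : (0 : ℝ) < 4)]
        nlinarith
      have hsqrt : Real.sqrt π / ell2 D ≤ 2 := by
        have : Real.sqrt π ≤ 2 := by
          rw [Real.sqrt_le_left (by norm_num)]; linarith [Real.pi_lt_four]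
        exact (div_le_self (Real.sqrt_nonneg _) hℓ2).trans this
      have he : Real.exp (1 / 4) ≤ 3 / 2 := by
        have h := Real.exp_one_lt_d9
        have h4 : Real.exp (1 / 4) ^ 4 = Real.exp 1 := by
          rw [← Real.exp_nat_mul]; norm_num
        by_contra hc
        rw [not_le] at hc
        have : (3 / 2 : ℝ) ^ 4 < Real.exp (1 / 4) ^ 4 := pow_lt_pow_left₀ hc (by norm_num) (by norm_num)
        rw [h4] at this
        norm_num at this
        linarith
      calc Real.sqrt π / ell2 D * Real.exp ((1 ^ 2 - v ^ 2) / (4 * ell2 D ^ 2))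
          ≤ 2 * (3 / 2) := mul_le_mul hsqrt (hexp.trans he) (Real.exp_pos _).le (by norm_num)
        _ = 3 := by norm_num
    have e1 := mul_le_mul h1 h2 (norm_nonneg _) hT0
    exact mul_le_mul e1 h3 (norm_nonneg _) (mul_nonneg hT0 (by positivity))
  -- continuity of both integrands along the line (for integrability of the difference)
  have hFc : Continuous fun v : ℝ => F ((1 : ℂ) + s0 D + v * I) := by
    have hL : ∀ y ∈ (Set.univ : Set ℝ), x.ψ.LFunction ((((3 / 2 : ℝ)) : ℂ) + y * I) ≠ 0 := by
      intro y _
      exact DirichletCharacter.LFunction_ne_zero_of_one_le_re x.ψ (Or.inl x.ψ_ne_one) (by simp; norm_num)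
    have hc := (continuousOn_kfrak3_omega_vertical c' χ x (3 / 2) hL)
    have hc' : Continuous fun y : ℝ => kfrak3 c' χ x ((((3 / 2 : ℝ)) : ℂ) + y * I) *
        omegaW D ((((3 / 2 : ℝ)) : ℂ) + y * I) :=
      continuousOn_univ.mp hc
    have heq : (fun v : ℝ => F ((1 : ℂ) + s0 D + v * I)) =
        (fun y : ℝ => kfrak3 c' χ x ((((3 / 2 : ℝ)) : ℂ) + y * I) *
          omegaW D ((((3 / 2 : ℝ)) : ℂ) + y * I)) ∘ (fun v : ℝ => 2 * π * t0 D + v) := by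
      funext v
      simp only [hF, Function.comp, hpt v]
    rw [heq]
    exact hc'.comp (by fun_prop)
  have hGc : Continuous fun v : ℝ => G ((1 : ℂ) + s0 D + v * I) := by
    have hline : Continuous fun v : ℝ => (1 : ℂ) + s0 D + v * I := by fun_prop
    have h1 : Continuous fun s : ℂ => ∑ m ∈ Finset.Icc 1 M, nuStar c' χ m * psiFn x m * (m : ℂ) ^ (-s) :=
      (differentiable_head c' χ x M).continuous
    have h2 : Continuous fun s : ℂ => FpolyBar χ x (1 - s) :=
      (differentiable_FpolyBar' χ x).continuous.comp (by fun_prop)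
    have h3 : Continuous (omegaW D) := (Section7aStatements.differentiable_omegaW D).continuous
    exact ((h1.mul h2).mul h3).comp hline
  -- the integral of the difference
  rw [Lemma81.segInt_def, Lemma81.segInt_def, ← mul_sub]
  change ‖(1 / (2 * π) : ℂ) * ((∫ v in (-ell1 D)..ell1 D, F ((1 : ℂ) + s0 D + v * I)) -
      ∫ v in (-ell1 D)..ell1 D, G ((1 : ℂ) + s0 D + v * I))‖ ≤ _
  rw [← intervalIntegral.integral_sub (hFc.intervalIntegrable _ _) (hGc.intervalIntegrable _ _)]
  have hint : ‖∫ v in (-ell1 D)..ell1 D, (F ((1 : ℂ) + s0 D + v * I) - G ((1 : ℂ) + s0 D + v * I))‖ ≤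
      (T * (D : ℝ) ^ 56 * 3) * |ell1 D - -ell1 D| :=
    intervalIntegral.norm_integral_le_of_norm_le_const fun v _ => hbound v
  have h2π : ‖(1 / (2 * π) : ℂ)‖ = 1 / (2 * π) := by
    rw [norm_div, norm_one, norm_mul, Complex.norm_real, Real.norm_eq_abs, abs_of_pos Real.pi_pos]
    norm_num
  rw [norm_mul, h2π]
  have habs : |ell1 D - -ell1 D| = 2 * ell1 D := by
    rw [sub_neg_eq_add, ← two_mul, abs_of_nonneg (by linarith)]
  rw [habs] at hint
  calc 1 / (2 * π) * ‖∫ v in (-ell1 D)..ell1 D,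
        (F ((1 : ℂ) + s0 D + v * I) - G ((1 : ℂ) + s0 D + v * I))‖
      ≤ 1 / (2 * π) * ((T * (D : ℝ) ^ 56 * 3) * (2 * ell1 D)) :=
        mul_le_mul_of_nonneg_left hint (by positivity)
    _ = (ell1 D / π) * T * (D : ℝ) ^ 56 * 3 := by ring

omit [NeZero D] in
/-- **"We move the path of integration to `𝔍(0)`"** (§7 p.35, tex L1893) for the head integrand
`G(s) = K_M(s,ψ)F(1−s,ψ̄)ω(s)`, which is entire: for `𝓛 ≥ 3`, `D ≥ 1`, `M ≥ 1`, every `ψ ∈ Ψ`,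
`‖(1/2πi)∫_{𝔍(1)}G − (1/2πi)∫_{𝔍(0)}G‖ ≤ (1/π)·K_ιM⁸·D⁵⁶·6e^{−𝓛¹⁰/4}` (Cauchy's theorem on
`[½, 3/2] × [2πt₀−𝓛₁, 2πt₀+𝓛₁]`, `Section7aStatements.norm_intJ_sub_intJ_le`; on the horizontal sides
`|K_M| ≤ K_ιM⁸`, `|F(1−s,ψ̄)| ≤ D⁵⁶`, `|ω| ≤ 6e^{−𝓛¹⁰/4}`).
[cite: Zhang2022LandauSiegel, §7 p.35, tex L1893; §17 (17.2) p.95] -/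
theorem norm_segInt_head_shift_le (hD1 : 1 ≤ D) (hℓ : 3 ≤ ell D) (x : Chr D) (M : ℕ) :
    ‖Lemma81.segInt (t0 D) (ell1 D) 1 (fun s =>
          (∑ m ∈ Finset.Icc 1 M, nuStar c' χ m * psiFn x m * (m : ℂ) ^ (-s)) *
            FpolyBar χ x (1 - s) * omegaW D s) -
        Lemma81.segInt (t0 D) (ell1 D) 0 (fun s =>
          (∑ m ∈ Finset.Icc 1 M, nuStar c' χ m * psiFn x m * (m : ℂ) ^ (-s)) *
            FpolyBar χ x (1 - s) * omegaW D s)‖ ≤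
      (1 / π) * ((1 + ‖iota2‖) * (‖iota3‖ + ‖iota4‖) * (M : ℝ) ^ 8 * (D : ℝ) ^ 56 *
        (6 * Real.exp (-(ell D ^ 10) / 4))) := by
  have hlog : 2 ≤ Real.log D := le_trans (by norm_num) hℓ
  have hℓ10 : 0 ≤ ell1 D := pow_nonneg (by linarith) _
  set G : ℂ → ℂ := fun s => (∑ m ∈ Finset.Icc 1 M, nuStar c' χ m * psiFn x m * (m : ℂ) ^ (-s)) *
    FpolyBar χ x (1 - s) * omegaW D s with hG
  set Mval : ℝ := (1 + ‖iota2‖) * (‖iota3‖ + ‖iota4‖) * (M : ℝ) ^ 8 * (D : ℝ) ^ 56 *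
    (6 * Real.exp (-(ell D ^ 10) / 4)) with hMval
  have hMval0 : 0 ≤ Mval := by rw [hMval]; exact mul_nonneg (mul_nonneg (mul_nonneg Kiota_nonneg
    (by positivity)) (by positivity)) (by positivity)
  -- holomorphy on the rectangle (everywhere)
  have hGd : Differentiable ℂ G :=
    (((differentiable_head c' χ x M).mul ((differentiable_FpolyBar' χ x).comp
      (by fun_prop))).mul (Section7aStatements.differentiable_omegaW D))
  have hGon : DifferentiableOn ℂ G (Set.uIcc (1 / 2 + (0 : ℝ)) (1 / 2 + 1) ×ℂ
      Set.uIcc (2 * π * t0 D - ell1 D) (2 * π * t0 D + ell1 D)) := hGd.differentiableOn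
  -- the horizontal sides
  have hside : ∀ t : ℝ, (t = 2 * π * t0 D + ell1 D ∨ t = 2 * π * t0 D - ell1 D) →
      ∀ u ∈ Set.Icc (1 / 2 + (0 : ℝ)) (1 / 2 + 1), ‖G ((u : ℂ) + ((t : ℝ) : ℂ) * I)‖ ≤ Mval := by
    intro t ht u hu
    obtain ⟨hu1, hu2⟩ := hu
    set s : ℂ := (u : ℂ) + ((t : ℝ) : ℂ) * I with hs
    have hsre : s.re = u := by simp [hs]
    have h1 : ‖∑ m ∈ Finset.Icc 1 M, nuStar c' χ m * psiFn x m * (m : ℂ) ^ (-s)‖ ≤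
        (1 + ‖iota2‖) * (‖iota3‖ + ‖iota4‖) * (M : ℝ) ^ 8 :=
      norm_head_le c' χ hlog x M (by rw [hsre]; linarith)
    have h2 : ‖FpolyBar χ x (1 - s)‖ ≤ (D : ℝ) ^ 56 :=
      Section4.norm_FpolyBar_le_pow χ x hD1 (by simp [hsre]; linarith)
    have h3 : ‖omegaW D s‖ ≤ 6 * Real.exp (-(ell D ^ 10) / 4) := by
      have hs' : s = ((u - 1 / 2 : ℝ) : ℂ) + SmoothWeight.s0 (t0 D) + ((t - 2 * π * t0 D : ℝ) : ℂ) * I := by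
        rw [hs, SmoothWeight.s0_def]; push_cast; ring
      have hℓ2 : 0 < ell2 D := pow_pos (by linarith) _
      rw [omegaW, hs', SmoothWeight.norm_omega_segment_eq hℓ2]
      have hsq : (t - 2 * π * t0 D) ^ 2 = ell1 D ^ 2 := by
        rcases ht with ht' | ht' <;> rw [ht'] <;> ring
      rw [hsq]
      exact Step8u016.omega_edge_le hℓ (z := u - 1 / 2) (by nlinarith)
    calc ‖G s‖ = ‖∑ m ∈ Finset.Icc 1 M, nuStar c' χ m * psiFn x m * (m : ℂ) ^ (-s)‖ *
          ‖FpolyBar χ x (1 - s)‖ * ‖omegaW D s‖ := by rw [hG]; simp only [norm_mul]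
      _ ≤ (1 + ‖iota2‖) * (‖iota3‖ + ‖iota4‖) * (M : ℝ) ^ 8 * (D : ℝ) ^ 56 *
          (6 * Real.exp (-(ell D ^ 10) / 4)) := by
          have e1 := mul_le_mul h1 h2 (norm_nonneg _) (mul_nonneg Kiota_nonneg (by positivity))
          exact mul_le_mul e1 h3 (norm_nonneg _)
            (mul_nonneg (mul_nonneg Kiota_nonneg (by positivity)) (by positivity))
  have hmove := Section7aStatements.norm_intJ_sub_intJ_le D (z₁ := 0) (z₂ := 1) (M₁ := Mval)
    (M₂ := Mval) (by norm_num) hGon (hside _ (Or.inl rfl)) (hside _ (Or.inr rfl))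
  -- `segInt 1 − segInt 0 = (intJ 1 − intJ 0)/(2πi)`
  have hI : Lemma81.segInt (t0 D) (ell1 D) 1 G - Lemma81.segInt (t0 D) (ell1 D) 0 G =
      (Section7aStatements.intJ D 1 G - Section7aStatements.intJ D 0 G) / (2 * π * I) := by
    rw [show (1 : ℂ) = ((1 : ℝ) : ℂ) by norm_num, show (0 : ℂ) = ((0 : ℝ) : ℂ) by norm_num,
      Step8u016.segInt_eq_intJ_div, Step8u016.segInt_eq_intJ_div, sub_div]
  have hnorm2 : ‖(2 : ℂ) * π * I‖ = 2 * π := by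
    rw [norm_mul, norm_mul, Complex.norm_I, mul_one, Complex.norm_real, Real.norm_eq_abs,
      abs_of_pos Real.pi_pos]
    norm_num
  rw [hI, norm_div, hnorm2, div_le_iff₀ (by positivity)]
  calc ‖Section7aStatements.intJ D 1 G - Section7aStatements.intJ D 0 G‖
      ≤ (1 - 0) * (Mval + Mval) := hmove
    _ = 1 / π * Mval * (2 * π) := by field_simp; ring

end Segment

end Literature.NumberTheory.LFunctions.Zhang2022.Eq172

end
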